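import Literature.AlgebraicGeometry.Motives.MiddleConvolution
import HarnessLib

/-!
# Multiplicativity of the middle convolution: `MC_{λ₂} ∘ MC_{λ₁} ≅ MC_{λ₁λ₂}`

This file discharges the named fact `DettweilerReiter2007_mul` of
`Literature.AlgebraicGeometry.Motives.MiddleConvolution` ([DettweilerReiter2007, Thm. 2.4 (ii)],
whose proof is "analogous to [DettweilerReiter2000, Thm. 3.5]"): for a module `(A, V)` over the
free group `F_ι` over a field satisfying `(*)` and `(**)` ([DettweilerReiter2007, Def. 2.3]) and
units `λ₁, λ₂`, `MC_{λ₂}(MC_{λ₁}(V)) ≅ MC_{λ₁λ₂}(V)` as `F_ι`-modules.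

## The printed proof and this formalisation

We follow [DettweilerReiter2000, §3, proof of Thm. 3.5] (in the block-row convention of
[DettweilerReiter2007, Def. 2.1] used by the tree file).  Write `G_i = B_i(A, λ₁)` for the
convolution operators on `V^ι`, `N₁ = 𝒦₁ + ℒ₁ ⊆ V^ι`, `M = MC_{λ₁}(V) = V^ι/N₁`,
`H_i = B_i(G, λ₂)` on `(V^ι)^ι`, `G'_i = B_i(A, λ₁λ₂)` and `N' = 𝒦' + ℒ'`.  Dettweiler–Reiter's map
`φ : (V^ι)^ι → V^ι, (v_1, …, v_r) ↦ Σ_i (G_i - 1) v_i` has coordinates `(φ v)_j = D_j(v_j)`, the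
`j`-th *defect* of `v_j` (`MiddleConvolution.defect`, the `j`-th block row of `G_j - 1`).
* `defect_defect_eq` / `phi_convolutionEnd`: `φ ∘ H_i = G'_i ∘ φ` — the block computation at the
  end of the printed proof ("`φ ∘ (H_i - 1) = (G'_i - 1) ∘ φ`").
* `defect_surjective`: `φ` is onto under `(**)` ("the map `φ` is surjective by the definition of
  `G_i`").
* `mem_kerSum_iff`: `w ∈ 𝒦 + ℒ ⇔ D_i(w) ∈ (λ - 1)·ker(A_i - 1)` for all `i` — the bookkeeping behind
  [DettweilerReiter2000, Lemma 3.3 and Prop. 3.4]; `single_mem_kerSum_iff`: under `(*)` a vector of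
  `𝒦 + ℒ` supported in one slot lies in `𝒦` (loc. cit., proof of Lemma 3.3 (i)).
* `pi_mk_mem_kerSum_iff`: the preimage of `𝒦_M + ℒ_M` in `(V^ι)^ι` is exactly `φ⁻¹(N')` (this
  replaces the dimension count of the printed proof by a direct two-sided argument, valid for all
  `λ₁, λ₂` including the cases `λ₁ = 1`, `λ₂ = 1`, `λ₁λ₂ = 1` that the source reduces to
  [DettweilerReiter2000, Prop. 3.2]); hence `φ` descends to a bijective intertwining map
  `MC_{λ₂}(MC_{λ₁}(V)) → MC_{λ₁λ₂}(V)` (`DettweilerReiter2007_mul_holds`).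

Only `(*)` and `(**)` at `τ = λ₁` (and `(*)` at `τ = 1`) are used; finite-dimensionality is not.
-/

noncomputable section

namespace Literature.AlgebraicGeometry.Motives

namespace MiddleConvolution

section DefectCalculus

variable {K : Type*} [CommRing K] {V : Type*} [AddCommGroup V] [Module K V]
variable {ι : Type*} [Fintype ι] [LinearOrder ι]

/-- `D_k(w) = λ A_k w_k + Σ_{j≠k} (B_k)_{kj} w_j - w_k`. [folklore] -/
theorem defect_eq (A : ι → Module.End K V) (c : K) (w : ι → V) (k : ι) :
    defect A c w k = c • A k (w k) + offDiag A c k w - w k := by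
  rw [defect, convolutionEnd_apply, Function.update_self]

/-- The `k`-th defect is the `k`-th coordinate of `(B_k - 1) w`. [folklore] -/
theorem defect_eq_sub_apply (A : ι → Module.End K V) (c : K) (w : ι → V) (k : ι) :
    defect A c w k = (convolutionEnd A c k - 1) w k := rfl

/-- The defect is additive in the vector. [folklore] -/
theorem defect_add (A : ι → Module.End K V) (c : K) (w w' : ι → V) (k : ι) :
    defect A c (w + w') k = defect A c w k + defect A c w' k := by
  simp only [defect_eq_sub_apply, _root_.map_add, Pi.add_apply]

/-- The defect is homogeneous in the vector. [folklore] -/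
theorem defect_smul (A : ι → Module.End K V) (c d : K) (w : ι → V) (k : ι) :
    defect A c (d • w) k = d • defect A c w k := by
  simp only [defect_eq_sub_apply, map_smul, Pi.smul_apply]

/-- The defect is subtractive in the vector. [folklore] -/
theorem defect_sub (A : ι → Module.End K V) (c : K) (w w' : ι → V) (k : ι) :
    defect A c (w - w') k = defect A c w k - defect A c w' k := by
  simp only [defect_eq_sub_apply, map_sub, Pi.sub_apply]

/-- The defect of `0` vanishes. [folklore] -/
theorem defect_zero (A : ι → Module.End K V) (c : K) (k : ι) :
    defect A c (0 : ι → V) k = 0 := by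
  simp only [defect_eq_sub_apply, map_zero, Pi.zero_apply]

/-- The defect of a finite sum. [folklore] -/
theorem defect_sum {α : Type*} (A : ι → Module.End K V) (c : K) (s : Finset α) (f : α → ι → V)
    (k : ι) : defect A c (∑ x ∈ s, f x) k = ∑ x ∈ s, defect A c (f x) k := by
  simp only [defect_eq_sub_apply, map_sum, Finset.sum_apply]

/-- `(B_k - 1) w` is the vector with the single non-zero block `D_k(w)` in slot `k`
([DettweilerReiter2000, proofs of Lemma 3.3 and Thm. 3.5]: "`(G_i - 1)w = (0, …, 0, *, 0, …, 0)`").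
[cite: DettweilerReiter2000, Lemma 3.3] -/
theorem convolutionEnd_sub_self (A : ι → Module.End K V) (c : K) (k : ι) (w : ι → V) :
    convolutionEnd A c k w - w = Pi.single k (defect A c w k) := by
  ext i
  rcases eq_or_ne i k with rfl | h
  · rw [Pi.single_eq_same, Pi.sub_apply, defect]
  · rw [Pi.sub_apply, convolutionEnd_apply, Function.update_of_ne h, Pi.single_eq_of_ne h, sub_self]

/-- The off-diagonal part of row `k` does not see a vector supported in slot `k`. [folklore] -/
theorem offDiag_single_self (A : ι → Module.End K V) (c : K) (k : ι) (z : V) :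
    offDiag A c k (Pi.single k z) = 0 := by
  rw [offDiag_apply]
  refine Finset.sum_eq_zero fun j hj => ?_
  rw [Pi.single_eq_of_ne (Finset.ne_of_mem_erase hj), map_zero]

/-- The off-diagonal part of row `k` on a vector supported in slot `j ≠ k` is `(B_k)_{kj} z`.
[folklore] -/
theorem offDiag_single_of_ne (A : ι → Module.End K V) (c : K) {k j : ι} (h : j ≠ k) (z : V) :
    offDiag A c k (Pi.single j z) = coeff A c k j z := by
  rw [offDiag_apply, Finset.sum_eq_single j]
  · rw [Pi.single_eq_same]
  · intro m _ hm
    rw [Pi.single_eq_of_ne hm, map_zero]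
  · intro hj
    exact absurd (Finset.mem_erase.2 ⟨h, Finset.mem_univ j⟩) hj

/-- `D_k` of a vector supported in slot `k`: `(λ A_k - 1) z`. [folklore] -/
theorem defect_single_self (A : ι → Module.End K V) (c : K) (k : ι) (z : V) :
    defect A c (Pi.single k z) k = c • A k z - z := by
  rw [defect_eq, offDiag_single_self, add_zero, Pi.single_eq_same]

/-- `D_k` of a vector supported in slot `j ≠ k`: `(B_k)_{kj} z` (`= λ(A_j - 1)z` or `(A_j - 1)z`).
[folklore] -/
theorem defect_single_of_ne (A : ι → Module.End K V) (c : K) {k j : ι} (h : j ≠ k) (z : V) :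
    defect A c (Pi.single j z) k = coeff A c k j z := by
  rw [defect_eq, offDiag_single_of_ne A c h, Pi.single_eq_of_ne h.symm, map_zero, smul_zero,
    zero_add, sub_zero]

/-- For `λ = 1` every defect is `Σ_j (A_j - 1) w_j` ([DettweilerReiter2000, Lemma 2.7 (a)]:
for `λ = 1`, `ℒ = {(v_i) | Σ (A_i - 1) v_i = 0}`). [cite: DettweilerReiter2000, Lemma 2.7] -/
theorem defect_one (A : ι → Module.End K V) (w : ι → V) (k : ι) :
    defect A 1 w k = ∑ j, (A j (w j) - w j) := by
  rw [defect_eq_sum]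
  refine Finset.sum_congr rfl fun j _ => ?_
  unfold dTerm
  by_cases h1 : j < k
  · rw [if_pos h1, one_smul]
  · rw [if_neg h1]
    by_cases h2 : j = k
    · rw [if_pos h2, h2, one_smul]
    · rw [if_neg h2]

/-- On `𝒦` the `k`-th defect is `(λ - 1) w_k`. [cite: DettweilerReiter2007, §2.1] -/
theorem defect_of_mem_fixedVectors {ρ : Representation K (FreeGroup ι) V} {v : ι → V}
    (hv : v ∈ fixedVectors ρ) (c : K) (k : ι) : defect (tuple ρ) c v k = (c - 1) • v k := by
  rw [defect, convolutionEnd_apply_of_mem_fixedVectors hv, Function.update_self, sub_smul, one_smul]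

/-- On `ℒ` all defects vanish. [cite: DettweilerReiter2007, §2.1] -/
theorem defect_of_mem_invariants {ρ : Representation K (FreeGroup ι) V} (l : Kˣ) {v : ι → V}
    (hv : v ∈ (convolution ρ l).invariants) (k : ι) : defect (tuple ρ) (l : K) v k = 0 := by
  rw [← convolutionEnd_eq_self_iff]
  exact (mem_invariants_convolution_iff ρ l v).1 hv k

/-- **Membership criterion for `𝒦 + ℒ`**: `w ∈ 𝒦 + ℒ` iff every defect `D_k(w)` lies in
`(λ - 1) · ker(A_k - 1)` (the bookkeeping of [DettweilerReiter2000, Lemma 3.3, Prop. 3.4]; valid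
for every `λ`, also `λ = 1`). [cite: DettweilerReiter2000, Lemma 3.3] -/
theorem mem_kerSum_iff (ρ : Representation K (FreeGroup ι) V) (l : Kˣ) (w : ι → V) :
    w ∈ kerSum ρ l ↔
      ∀ k, ∃ y, ρ (FreeGroup.of k) y = y ∧ defect (tuple ρ) (l : K) w k = ((l : K) - 1) • y := by
  constructor
  · intro hw k
    rw [kerSum, Submodule.mem_sup] at hw
    obtain ⟨v, hv, u, hu, rfl⟩ := hw
    refine ⟨v k, (mem_fixedVectors_iff ρ v).1 hv k, ?_⟩
    rw [defect_add, defect_of_mem_fixedVectors hv, defect_of_mem_invariants l hu, add_zero]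
  · intro h
    choose y hy hd using h
    have hyK : y ∈ fixedVectors ρ := (mem_fixedVectors_iff ρ _).2 hy
    have hL : w - y ∈ (convolution ρ l).invariants := by
      rw [mem_invariants_convolution_iff]
      intro k
      rw [convolutionEnd_eq_self_iff, defect_sub, hd, defect_of_mem_fixedVectors hyK, sub_self]
    have := Submodule.add_mem_sup hyK hL
    rwa [add_sub_cancel] at this

omit [Fintype ι] in
/-- A vector supported in slot `i` with value fixed by `A_i` lies in `𝒦`. [folklore] -/
theorem single_mem_fixedVectors {ρ : Representation K (FreeGroup ι) V} {i : ι} {y : V}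
    (hy : ρ (FreeGroup.of i) y = y) : Pi.single i y ∈ fixedVectors ρ := by
  rw [mem_fixedVectors_iff]
  intro m
  rcases eq_or_ne m i with rfl | h
  · rw [Pi.single_eq_same, hy]
  · rw [Pi.single_eq_of_ne h, map_zero]

/-- **Single-slot lemma** ([DettweilerReiter2000, proof of Lemma 3.3 (i)]): under condition `(*)`
at `(i, λ)`, a vector of `𝒦 + ℒ` supported in the `i`-th slot already lies in `𝒦`, i.e. its value
is fixed by `A_i`. [cite: DettweilerReiter2000, Lemma 3.3] -/
theorem single_mem_kerSum_iff (ρ : Representation K (FreeGroup ι) V) (l : Kˣ) {i : ι}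
    (hS : (⨅ j ∈ {j | j ≠ i}, LinearMap.ker (tuple ρ j - 1)) ⊓
      LinearMap.ker ((l : K) • tuple ρ i - 1) = ⊥) (y : V) :
    Pi.single i y ∈ kerSum ρ l ↔ ρ (FreeGroup.of i) y = y := by
  refine ⟨fun h => ?_, fun hy => Submodule.mem_sup_left (single_mem_fixedVectors hy)⟩
  rw [mem_kerSum_iff] at h
  -- `u = (A_i - 1) y` lies in `⋂_{m ≠ i} ker(A_m - 1) ∩ ker(λ A_i - 1) = 0`.
  have h1 : ∀ m, m ≠ i → tuple ρ m (tuple ρ i y - y) = tuple ρ i y - y := by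
    intro m hm
    obtain ⟨y', hy', hd⟩ := h m
    rw [defect_single_of_ne (tuple ρ) _ hm.symm] at hd
    unfold coeff at hd
    have key : ∃ d : K, tuple ρ i y - y = d • y' := by
      split_ifs at hd
      · refine ⟨((l⁻¹ : Kˣ) : K) * ((l : K) - 1), ?_⟩
        have h2 : (l : K) • (tuple ρ i y - y) = ((l : K) - 1) • y' := by
          rw [← hd, LinearMap.smul_apply, LinearMap.sub_apply, Module.End.one_apply]
        calc tuple ρ i y - y = ((l⁻¹ : Kˣ) : K) • ((l : K) • (tuple ρ i y - y)) := by
              rw [smul_smul, Units.inv_mul, one_smul]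
          _ = _ := by rw [h2, smul_smul]
      · exact ⟨(l : K) - 1, by rw [← hd, LinearMap.sub_apply, Module.End.one_apply]⟩
    obtain ⟨d, hd'⟩ := key
    rw [hd', map_smul]
    exact congrArg (d • ·) hy'
  have h2 : ((l : K) • tuple ρ i - 1) (tuple ρ i y - y) = 0 := by
    obtain ⟨y', hy', hd⟩ := h i
    rw [defect_single_self] at hd
    have h3 : ((l : K) • tuple ρ i - 1) (tuple ρ i y - y) =
        tuple ρ i ((l : K) • tuple ρ i y - y) - ((l : K) • tuple ρ i y - y) := by
      simp only [LinearMap.sub_apply, LinearMap.smul_apply, Module.End.one_apply, map_sub,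
        map_smul]
    rw [h3, hd, map_smul]
    exact sub_eq_zero.2 (congrArg (((l : K) - 1) • ·) hy')
  have hmem : tuple ρ i y - y ∈ (⨅ j ∈ {j | j ≠ i}, LinearMap.ker (tuple ρ j - 1)) ⊓
      LinearMap.ker ((l : K) • tuple ρ i - 1) := by
    refine Submodule.mem_inf.2 ⟨?_, h2⟩
    simp only [Submodule.mem_iInf]
    intro j hj
    rw [LinearMap.mem_ker, LinearMap.sub_apply, Module.End.one_apply, h1 j hj, sub_self]
  rw [hS, Submodule.mem_bot] at hmem
  exact sub_eq_zero.1 hmem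

end DefectCalculus

section Key

variable {K : Type*} [CommRing K] {V : Type*} [AddCommGroup V] [Module K V]
variable {ι : Type*} [Fintype ι] [LinearOrder ι]
variable (ρ : Representation K (FreeGroup ι) V) (a b : Kˣ)

/-- **The key identity** behind `φ ∘ (H_i - 1) = (G'_i - 1) ∘ φ`
([DettweilerReiter2000, end of the proof of Thm. 3.5]): with `G = C_{λ₁}(A)`, the `λ₁`-defect of
the `λ₂`-defect `D^{G,λ₂}_i(v) ∈ V^ι` of `v ∈ (V^ι)^ι` equals the `λ₁λ₂`-defect of
`z = φ(v) = (D_j(v_j))_j`. [cite: DettweilerReiter2000, Theorem 3.5] -/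
theorem defect_defect_eq (v : ι → ι → V) (z : ι → V)
    (hz : ∀ j, defect (tuple ρ) (a : K) (v j) j = z j) (i : ι) :
    defect (tuple ρ) (a : K) (defect (tuple (convolution ρ a)) (b : K) v i) i =
      defect (tuple ρ) ((a * b : Kˣ) : K) z i := by
  rw [Units.val_mul]
  have hG : ∀ j, tuple (convolution ρ a) j = convolutionEnd (tuple ρ) (a : K) j :=
    fun j => convolution_of ρ a j
  have hsingle : ∀ j, (tuple (convolution ρ a) j - 1) (v j) = Pi.single j (z j) := by
    intro j
    rw [LinearMap.sub_apply, Module.End.one_apply, hG, convolutionEnd_sub_self, hz]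
  have hGi : tuple (convolution ρ a) i (v i) = v i + Pi.single i (z i) := by
    rw [← sub_eq_iff_eq_add', ← hsingle i, LinearMap.sub_apply, Module.End.one_apply]
  -- expand the inner (`λ₂`-)defect
  have hY : defect (tuple (convolution ρ a)) (b : K) v i =
      (b : K) • (v i + Pi.single i (z i)) +
        ∑ j ∈ Finset.univ.erase i, (if j < i then (b : K) else 1) • Pi.single j (z j) - v i := by
    rw [defect_eq, offDiag_apply, hGi]
    congr 2
    refine Finset.sum_congr rfl fun j _ => ?_
    unfold coeff
    split_ifs
    · rw [LinearMap.smul_apply, hsingle]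
    · rw [one_smul, hsingle]
  rw [hY, defect_sub, defect_add, defect_smul, defect_add, defect_sum, defect_single_self, hz]
  simp only [defect_smul]
  have hsum : ∑ j ∈ Finset.univ.erase i,
      (if j < i then (b : K) else 1) • defect (tuple ρ) (a : K) (Pi.single j (z j)) i =
        ∑ j ∈ Finset.univ.erase i, coeff (tuple ρ) ((a : K) * b) i j (z j) := by
    refine Finset.sum_congr rfl fun j hj => ?_
    rw [defect_single_of_ne (tuple ρ) _ (Finset.ne_of_mem_erase hj)]
    unfold coeff
    split_ifs
    · rw [LinearMap.smul_apply, LinearMap.smul_apply, smul_smul, mul_comm]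
    · rw [one_smul]
  rw [hsum, defect_eq (tuple ρ) ((a : K) * b) z i, offDiag_apply, add_sub_cancel, smul_smul,
    mul_comm (b : K)]

/-- **`φ` intertwines `H_i = B_i(C_{λ₁}(A), λ₂)` and `G'_i = B_i(A, λ₁λ₂)`**
([DettweilerReiter2000, proof of Thm. 3.5]: "`φ ∘ (H_i - 1) = (G'_i - 1) ∘ φ`"), where
`φ(v) = Σ_j (G_j - 1) v_j = (D_j(v_j))_j`. [cite: DettweilerReiter2000, Theorem 3.5] -/
theorem phi_convolutionEnd (v : ι → ι → V) (i : ι) :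
    (fun j => defect (tuple ρ) (a : K) (convolutionEnd (tuple (convolution ρ a)) (b : K) i v j) j) =
      convolutionEnd (tuple ρ) ((a * b : Kˣ) : K) i (fun j => defect (tuple ρ) (a : K) (v j) j) := by
  funext j
  by_cases hji : j = i
  · subst hji
    have h1 : convolutionEnd (tuple (convolution ρ a)) (b : K) j v j =
        v j + defect (tuple (convolution ρ a)) (b : K) v j := by
      rw [defect, add_sub_cancel]
    have h2 : convolutionEnd (tuple ρ) ((a * b : Kˣ) : K) j
        (fun j => defect (tuple ρ) (a : K) (v j) j) j =
          (fun j => defect (tuple ρ) (a : K) (v j) j) j +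
            defect (tuple ρ) ((a * b : Kˣ) : K) (fun j => defect (tuple ρ) (a : K) (v j) j) j := by
      rw [defect, add_sub_cancel]
    rw [h1, defect_add, defect_defect_eq ρ a b v _ (fun _ => rfl) j, h2]
  · rw [convolutionEnd_apply, Function.update_of_ne hji, convolutionEnd_apply,
      Function.update_of_ne hji]

/-- **`φ` is onto under `(**)`** ([DettweilerReiter2000, proof of Thm. 3.5]: "the map `φ` is
surjective by the definition of `G_i`"): if `Σ_{j≠i} im(A_j - 1) + im(λ A_i - 1) = V` then the
`i`-th defect `D_i : V^ι → V` is surjective. [cite: DettweilerReiter2000, Theorem 3.5] -/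
theorem defect_surjective {i : ι}
    (hSS : (⨆ j ∈ {j | j ≠ i}, LinearMap.range (tuple ρ j - 1)) ⊔
      LinearMap.range ((a : K) • tuple ρ i - 1) = ⊤) (t : V) :
    ∃ w : ι → V, defect (tuple ρ) (a : K) w i = t := by
  let F : (ι → V) →ₗ[K] V := (LinearMap.proj i).comp (convolutionEnd (tuple ρ) (a : K) i - 1)
  have hF : ∀ w, F w = defect (tuple ρ) (a : K) w i := fun w => rfl
  suffices h : ⊤ ≤ LinearMap.range F by
    obtain ⟨w, hw⟩ := LinearMap.range_eq_top.1 (top_le_iff.1 h) t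
    exact ⟨w, by rw [← hF, hw]⟩
  rw [← hSS]
  refine sup_le (iSup₂_le fun j hj => ?_) ?_
  · rintro _ ⟨y, rfl⟩
    have hj' : j ≠ i := hj
    refine ⟨Pi.single j ((if j < i then ((a⁻¹ : Kˣ) : K) else 1) • y), ?_⟩
    rw [hF, defect_single_of_ne (tuple ρ) _ hj']
    unfold coeff
    split_ifs
    · rw [LinearMap.smul_apply, map_smul, smul_smul, Units.mul_inv, one_smul]
    · rw [one_smul]
  · rintro _ ⟨y, rfl⟩
    refine ⟨Pi.single i y, ?_⟩
    rw [hF, defect_single_self, LinearMap.sub_apply, LinearMap.smul_apply, Module.End.one_apply]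

/-- `(G_j - 1)` maps `N₁ = 𝒦₁ + ℒ₁` into `𝒦 ⊆ 𝒦 + ℒ_μ` for every `μ`
([DettweilerReiter2000, proof of Thm. 3.5]: "`φ(K₁^r) = Σ (G_i - 1)(K₁) = K₁`", `ℒ₁^r ≤ ker φ`), so
`φ` descends to a linear map `ψ : M^ι → V^ι/(𝒦 + ℒ_μ)`, `M = MC_{λ₁}(V)`, with
`ψ((v_j mod N₁)_j) = φ(v) mod (𝒦 + ℒ_μ)`. [cite: DettweilerReiter2000, Theorem 3.5] -/
theorem exists_liftMap (μ : Kˣ) :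
    ∃ ψ : (ι → Space ρ a) →ₗ[K] Space ρ μ, ∀ v : ι → ι → V,
      ψ (fun j => Submodule.Quotient.mk (v j)) =
        Submodule.Quotient.mk (fun j => defect (tuple ρ) (a : K) (v j) j) := by
  have hle : ∀ j, kerSum ρ a ≤
      LinearMap.ker ((kerSum ρ μ).mkQ ∘ₗ (convolutionEnd (tuple ρ) (a : K) j - 1)) := by
    intro j w hw
    rw [LinearMap.mem_ker, LinearMap.comp_apply, Submodule.mkQ_apply, Submodule.Quotient.mk_eq_zero,
      LinearMap.sub_apply, Module.End.one_apply, convolutionEnd_sub_self]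
    obtain ⟨y, hy, hd⟩ := (mem_kerSum_iff ρ a w).1 hw j
    rw [hd]
    exact Submodule.mem_sup_left (single_mem_fixedVectors (by rw [map_smul, hy]))
  refine ⟨∑ j, ((kerSum ρ a).liftQ _ (hle j)) ∘ₗ LinearMap.proj j, fun v => ?_⟩
  rw [LinearMap.sum_apply]
  simp only [LinearMap.comp_apply, LinearMap.proj_apply, Submodule.liftQ_apply]
  rw [← map_sum, Submodule.mkQ_apply]
  congr 1
  have h1 : ∀ j, (convolutionEnd (tuple ρ) (a : K) j - 1) (v j) =
      Pi.single j (defect (tuple ρ) (a : K) (v j) j) := by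
    intro j
    rw [LinearMap.sub_apply, Module.End.one_apply, convolutionEnd_sub_self]
  simp_rw [h1]
  exact Finset.univ_sum_single _

omit [Fintype ι] [LinearOrder ι] in
/-- A linear map between two `F_ι`-modules that intertwines the generators intertwines the whole
free group. [folklore] -/
theorem isIntertwining_of_generators {M₁ M₂ : Type*} [AddCommGroup M₁] [Module K M₁]
    [AddCommGroup M₂] [Module K M₂] (ρ₁ : Representation K (FreeGroup ι) M₁)
    (ρ₂ : Representation K (FreeGroup ι) M₂) (f : M₁ →ₗ[K] M₂)
    (h : ∀ (k : ι) (x : M₁), f (ρ₁ (FreeGroup.of k) x) = ρ₂ (FreeGroup.of k) (f x))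
    (g : FreeGroup ι) (x : M₁) : f (ρ₁ g x) = ρ₂ g (f x) := by
  induction g using FreeGroup.induction_on generalizing x with
  | C1 => simp
  | of k => exact h k x
  | inv_of k ih =>
    have h1 : ρ₁ (FreeGroup.of k) (ρ₁ (FreeGroup.of k)⁻¹ x) = x := by
      rw [← Module.End.mul_apply, ← map_mul, mul_inv_cancel, map_one, Module.End.one_apply]
    have h2 := ih (ρ₁ (FreeGroup.of k)⁻¹ x)
    rw [h1] at h2
    rw [h2, ← Module.End.mul_apply, ← map_mul, inv_mul_cancel, map_one, Module.End.one_apply]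
  | mul x' y hx hy => rw [map_mul, Module.End.mul_apply, map_mul, Module.End.mul_apply, hx, hy]

end Key

section Main

variable {K : Type*} [Field K] {V : Type*} [AddCommGroup V] [Module K V]
variable {ι : Type*} [Fintype ι] [LinearOrder ι]
variable (ρ : Representation K (FreeGroup ι) V) (a b : Kˣ)

/-- Defects on `M^ι = (V^ι/N₁)^ι` are computed upstairs: `D^{MC_{λ₁}(A), λ₂}_i((v_j mod N₁)_j) =
D^{C_{λ₁}(A), λ₂}_i(v) mod N₁`. [folklore] -/
theorem defect_middleConvolution_pi (v : ι → ι → V) (i : ι) :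
    defect (tuple (middleConvolution ρ a)) (b : K)
        (fun j => (Submodule.Quotient.mk (v j) : Space ρ a)) i =
      Submodule.Quotient.mk (defect (tuple (convolution ρ a)) (b : K) v i) := by
  have h := piMap_convolutionEnd (MiddleConvolution.mkQ ρ a) (b : K) i v
  have hpi : ∀ w : ι → ι → V, piMap (MiddleConvolution.mkQ ρ a).toLinearMap w =
      fun j => (Submodule.Quotient.mk (w j) : Space ρ a) := fun w => rfl
  rw [hpi, hpi] at h
  rw [defect, ← h, defect, Submodule.Quotient.mk_sub]

/-- **The preimage of `𝒦_M + ℒ_M` is `φ⁻¹(𝒦' + ℒ')`** (`M = MC_{λ₁}(V)`, primes referring to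
`λ = λ₁λ₂`): for `v ∈ (V^ι)^ι`, `(v_j mod N₁)_j ∈ 𝒦_M + ℒ_M ⊆ M^ι` iff `φ(v) ∈ 𝒦' + ℒ' ⊆ V^ι`, under
`(*)`.  This is the content of [DettweilerReiter2000, Lemma 3.3 + the dimension count in the proof
of Thm. 3.5] (there for `λ₁, λ₂ ≠ 1`; the cases `λ₂ = 1` and `λ₁λ₂ = 1` are treated directly here).
[cite: DettweilerReiter2000, Theorem 3.5] -/
theorem pi_mk_mem_kerSum_iff (hS : CondStar ρ) (v : ι → ι → V) :
    (fun j => (Submodule.Quotient.mk (v j) : Space ρ a)) ∈ kerSum (middleConvolution ρ a) b ↔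
      (fun j => defect (tuple ρ) (a : K) (v j) j) ∈ kerSum ρ (a * b) := by
  -- Step 1: membership on the quotient side, lifted to `V^ι` (criterion for `MC_{λ₁}(V)` + (*)).
  have step1 : (fun j => (Submodule.Quotient.mk (v j) : Space ρ a)) ∈
      kerSum (middleConvolution ρ a) b ↔
        ∀ i, ∃ Y : ι → V,
          ρ (FreeGroup.of i) (defect (tuple ρ) (a : K) Y i) = defect (tuple ρ) (a : K) Y i ∧
            defect (tuple (convolution ρ a)) (b : K) v i - ((b : K) - 1) • Y ∈ kerSum ρ a := by
    rw [mem_kerSum_iff (middleConvolution ρ a) b]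
    refine forall_congr' fun i => ?_
    constructor
    · rintro ⟨ybar, hy, hd⟩
      obtain ⟨Y, rfl⟩ := Submodule.Quotient.mk_surjective _ ybar
      refine ⟨Y, ?_, ?_⟩
      · rw [middleConvolution_of_mk, Submodule.Quotient.eq, convolutionEnd_sub_self] at hy
        exact (single_mem_kerSum_iff ρ a (hS i a) _).1 hy
      · rw [defect_middleConvolution_pi, ← Submodule.Quotient.mk_smul, Submodule.Quotient.eq] at hd
        exact hd
    · rintro ⟨Y, hY, hd⟩
      refine ⟨Submodule.Quotient.mk Y, ?_, ?_⟩
      · rw [middleConvolution_of_mk, Submodule.Quotient.eq, convolutionEnd_sub_self]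
        exact (single_mem_kerSum_iff ρ a (hS i a) _).2 hY
      · rw [defect_middleConvolution_pi, ← Submodule.Quotient.mk_smul, Submodule.Quotient.eq]
        exact hd
  rw [step1, mem_kerSum_iff ρ (a * b)]
  constructor
  · intro h
    -- every `λ₁λ₂`-defect of `φ(v)` is fixed by the corresponding `A_i`
    have H1 : ∀ i, ρ (FreeGroup.of i)
        (defect (tuple ρ) ((a * b : Kˣ) : K) (fun j => defect (tuple ρ) (a : K) (v j) j) i) =
          defect (tuple ρ) ((a * b : Kˣ) : K) (fun j => defect (tuple ρ) (a : K) (v j) j) i := by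
      intro i
      obtain ⟨Y, hY, hX⟩ := h i
      obtain ⟨y₀, hy₀, hd₀⟩ := (mem_kerSum_iff ρ a _).1 hX i
      rw [defect_sub, defect_smul, defect_defect_eq ρ a b v _ (fun _ => rfl), sub_eq_iff_eq_add]
        at hd₀
      rw [hd₀, _root_.map_add, map_smul, map_smul, hy₀, hY]
    intro i
    by_cases hab : ((a * b : Kˣ) : K) = 1
    · refine ⟨0, by rw [map_zero], ?_⟩
      rw [smul_zero, hab]
      have hall : ∀ m, ρ (FreeGroup.of m)
          (defect (tuple ρ) 1 (fun j => defect (tuple ρ) (a : K) (v j) j) i) =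
            defect (tuple ρ) 1 (fun j => defect (tuple ρ) (a : K) (v j) j) i := by
        intro m
        have := H1 m
        rw [hab, defect_one] at this
        rwa [defect_one]
      have hmem : defect (tuple ρ) 1 (fun j => defect (tuple ρ) (a : K) (v j) j) i ∈
          (⨅ j ∈ {j | j ≠ i}, LinearMap.ker (tuple ρ j - 1)) ⊓
            LinearMap.ker (((1 : Kˣ) : K) • tuple ρ i - 1) := by
        refine Submodule.mem_inf.2 ⟨?_, ?_⟩
        · simp only [Submodule.mem_iInf]
          intro j _
          rw [LinearMap.mem_ker, LinearMap.sub_apply, Module.End.one_apply, sub_eq_zero]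
          exact hall j
        · rw [LinearMap.mem_ker, LinearMap.sub_apply, LinearMap.smul_apply, Units.val_one, one_smul,
            Module.End.one_apply, sub_eq_zero]
          exact hall i
      rw [hS i 1, Submodule.mem_bot] at hmem
      exact hmem
    · refine ⟨(((a * b : Kˣ) : K) - 1)⁻¹ •
          defect (tuple ρ) ((a * b : Kˣ) : K) (fun j => defect (tuple ρ) (a : K) (v j) j) i, ?_, ?_⟩
      · rw [map_smul, H1 i]
      · rw [smul_smul, mul_inv_cancel₀ (sub_ne_zero.2 hab), one_smul]
  · intro h
    by_cases hb : (b : K) = 1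
    · -- `λ₂ = 1`: then `D^{G,1}_i(v) = φ(v)` for every `i`, and `φ(v) ∈ N₁`.
      have hzmem : (fun j => defect (tuple ρ) (a : K) (v j) j) ∈ kerSum ρ a := by
        rw [mem_kerSum_iff]
        intro i
        obtain ⟨y, hy, hd⟩ := h i
        refine ⟨y, hy, ?_⟩
        rw [Units.val_mul, hb, mul_one] at hd
        exact hd
      have h1 : ∀ i, defect (tuple (convolution ρ a)) (1 : K) v i =
          fun j => defect (tuple ρ) (a : K) (v j) j := by
        intro i
        rw [defect_one]
        have h2 : ∀ j, tuple (convolution ρ a) j (v j) - v j =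
            Pi.single j (defect (tuple ρ) (a : K) (v j) j) := by
          intro j
          show convolution ρ a (FreeGroup.of j) (v j) - v j = _
          rw [convolution_of, convolutionEnd_sub_self]
        simp_rw [h2]
        exact Finset.univ_sum_single _
      intro i
      refine ⟨0, by rw [defect_zero, map_zero], ?_⟩
      rw [smul_zero, sub_zero, hb, h1]
      exact hzmem
    · intro i
      obtain ⟨y, hy, hd⟩ := h i
      refine ⟨((b : K) - 1)⁻¹ • defect (tuple (convolution ρ a)) (b : K) v i, ?_, ?_⟩
      · rw [defect_smul, defect_defect_eq ρ a b v _ (fun _ => rfl), map_smul, hd, map_smul, hy]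
      · rw [smul_smul, mul_inv_cancel₀ (sub_ne_zero.2 hb), one_smul, sub_self]
        exact Submodule.zero_mem _

end Main

end MiddleConvolution

section MulHolds

open MiddleConvolution

/-- **Multiplicativity of the middle convolution** [DettweilerReiter2007, Thm. 2.4 (ii)]
(= [DettweilerReiter2000, Thm. 3.5]): under `(*)` and `(**)`,
`MC_{λ₂}(MC_{λ₁}(V)) ≅ MC_{λ₁λ₂}(V)` as modules over the free group, the isomorphism being induced
by Dettweiler–Reiter's map `φ(v_1, …, v_r) = Σ_i (G_i - 1) v_i`.  Discharges the named fact
`DettweilerReiter2007_mul`. [cite: DettweilerReiter2007, Theorem 2.4 (ii)] -/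
theorem DettweilerReiter2007_mul_holds : DettweilerReiter2007_mul := by
  intro K _ V _ _ _ r ρ a b hS hSS
  obtain ⟨ψ, hψ⟩ := exists_liftMap ρ a (a * b)
  -- every element of `M^ι` lifts to `(V^ι)^ι`
  have hπ : ∀ x : Fin r → Space ρ a, ∃ v : Fin r → Fin r → V,
      (fun j => (Submodule.Quotient.mk (v j) : Space ρ a)) = x := by
    intro x
    choose v hv using fun j => Submodule.Quotient.mk_surjective (kerSum ρ a) (x j)
    exact ⟨v, funext hv⟩
  have hker : kerSum (middleConvolution ρ a) b ≤ LinearMap.ker ψ := by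
    intro x hx
    obtain ⟨v, rfl⟩ := hπ x
    rw [LinearMap.mem_ker, hψ, Submodule.Quotient.mk_eq_zero]
    exact (pi_mk_mem_kerSum_iff ρ a b hS v).1 hx
  -- the induced map `MC_{λ₂}(MC_{λ₁}(V)) → MC_{λ₁λ₂}(V)`
  set Ψ : Space (middleConvolution ρ a) b →ₗ[K] Space ρ (a * b) :=
    (kerSum (middleConvolution ρ a) b).liftQ ψ hker with hΨdef
  have hΨ : ∀ v : Fin r → Fin r → V,
      Ψ (Submodule.Quotient.mk (fun j => (Submodule.Quotient.mk (v j) : Space ρ a))) =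
        Submodule.Quotient.mk (fun j => defect (tuple ρ) (a : K) (v j) j) := by
    intro v
    rw [hΨdef, Submodule.liftQ_apply]
    exact hψ v
  have hequiv : ∀ (g : FreeGroup (Fin r)) (x : Space (middleConvolution ρ a) b),
      Ψ (middleConvolution (middleConvolution ρ a) b g x) = middleConvolution ρ (a * b) g (Ψ x) := by
    refine isIntertwining_of_generators _ _ Ψ fun k x => ?_
    obtain ⟨x, rfl⟩ := Submodule.Quotient.mk_surjective _ x
    obtain ⟨v, rfl⟩ := hπ x
    have h1 : convolutionEnd (tuple (middleConvolution ρ a)) (b : K) k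
        (fun j => (Submodule.Quotient.mk (v j) : Space ρ a)) =
          fun j => (Submodule.Quotient.mk (convolutionEnd (tuple (convolution ρ a)) (b : K) k v j) :
            Space ρ a) :=
      (piMap_convolutionEnd (MiddleConvolution.mkQ ρ a) (b : K) k v).symm
    rw [middleConvolution_of_mk, h1, hΨ, hΨ, middleConvolution_of_mk]
    exact congrArg Submodule.Quotient.mk (phi_convolutionEnd ρ a b v k)
  have hsurj : Function.Surjective Ψ := by
    intro t
    obtain ⟨z, rfl⟩ := Submodule.Quotient.mk_surjective _ t
    choose w hw using fun j => defect_surjective ρ a (hSS j a) (z j)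
    refine ⟨Submodule.Quotient.mk (fun j => (Submodule.Quotient.mk (w j) : Space ρ a)), ?_⟩
    rw [hΨ]
    congr 1
    funext j
    exact hw j
  have hinj : Function.Injective Ψ := by
    rw [← LinearMap.ker_eq_bot, eq_bot_iff]
    intro x hx
    obtain ⟨x, rfl⟩ := Submodule.Quotient.mk_surjective _ x
    obtain ⟨v, rfl⟩ := hπ x
    rw [LinearMap.mem_ker, hΨ, Submodule.Quotient.mk_eq_zero] at hx
    rw [Submodule.mem_bot, Submodule.Quotient.mk_eq_zero]
    exact (pi_mk_mem_kerSum_iff ρ a b hS v).2 hx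
  exact ⟨Representation.IntertwiningMap.ofBijective
    (LinearMap.intertwiningMap_of_isIntertwiningMap _ _ Ψ hequiv) ⟨hinj, hsurj⟩⟩

end MulHolds

end Literature.AlgebraicGeometry.Motives

end
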